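import Summits.Ventures.PercRepro.LemmaBM3

/-!
# Lemma B for maps whose image minus `{⊥, ⊤}` is an antichain; the rank-1 cells are the whole difficulty

`LemmaBM3.lean` covers monotone maps with values in `{⊥, ⊤} ∪ range x`. The same second-difference
table holds when further **neutral** cells are admitted — cells that are neither `⊥`, `⊤` nor a cell
of the family and that, together with the cells of the family, form an ANTICHAIN: the family kernel
vanishes on every pair involving a neutral cell, and a strict comparison between admissible cells
still starts at `⊥` or ends at `⊤`. Hence (`LemmaBFamily_of_antichain_image`) Lemma B holds for every
monotone map whose image minus `{⊥, ⊤}` is an antichain containing the crossing cells.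

At `k = 4` the four 3|1 cells `abc|d, abd|c, acd|b, bcd|a` are pairwise incomparable and incomparable
with the crossing cells, so **`LemmaB_of_no_rank1`**: a monotone map into `Part(4)` that never takes
one of the six rank-1 values `ab|c|d, …` satisfies Lemma B — for every `d`. Exact check
(`mining/p6/lp/subposet_smc.py`): on the sub-poset without the rank-1 cells the C-005 kernel has 0
second-difference failures; adding any single rank-1 cell creates 4. So the open case of Lemma B
(Part(4)) lives entirely in the rank-1 cells (the moves `r_j ⋖ x_j` against `x_i ⋖ ⊤`).
-/

namespace PercRepro

open Finset

section Antichain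

variable {k r : ℕ} {x : Fin r → Setoid (Fin k)} {O : Set (Setoid (Fin k))}

/-- The admissible cells with a set `O` of neutral cells: `⊥`, `⊤`, a cell of the family, or a
member of `O`. -/
def IsAdmissibleCell (x : Fin r → Setoid (Fin k)) (O : Set (Setoid (Fin k))) (s : Setoid (Fin k)) :
    Prop :=
  s = ⊥ ∨ s = ⊤ ∨ (∃ i, s = x i) ∨ s ∈ O

/-- A **neutral set** for the family `x`: its members are proper cells, not cells of the family,
and together with the cells of the family they form an antichain. -/
structure IsNeutral (x : Fin r → Setoid (Fin k)) (O : Set (Setoid (Fin k))) : Prop where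
  ne_bot : ∀ o ∈ O, o ≠ ⊥
  ne_top : ∀ o ∈ O, o ≠ ⊤
  ne_cell : ∀ o ∈ O, ∀ i, o ≠ x i
  not_le_cell : ∀ o ∈ O, ∀ i, ¬ o ≤ x i
  not_cell_le : ∀ o ∈ O, ∀ i, ¬ x i ≤ o
  antichain : ∀ o ∈ O, ∀ o' ∈ O, o ≤ o' → o = o'

open Classical in
/-- The family kernel vanishes when its first argument is neutral. -/
theorem crossKernel_neutral_left (hO : IsNeutral x O) {o : Setoid (Fin k)} (ho : o ∈ O)
    (τ : Setoid (Fin k)) : crossKernel x o τ = 0 := by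
  unfold crossKernel
  have h1 : ∀ i j : Fin r, (if i ≠ j ∧ τ = x i ∧ o = x j then (1 : ℝ) else 0) = 0 := by
    intro i j
    rw [if_neg]
    rintro ⟨-, -, h⟩
    exact hO.ne_cell o ho j h
  rw [if_neg (fun h => hO.ne_top o ho h.1), if_neg (fun h => hO.ne_bot o ho h.1),
    Finset.sum_eq_zero (fun i _ => Finset.sum_eq_zero (fun j _ => h1 i j))]
  norm_num

open Classical in
/-- The family kernel vanishes when its second argument is neutral. -/
theorem crossKernel_neutral_right (hO : IsNeutral x O) {o : Setoid (Fin k)} (ho : o ∈ O)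
    (σ : Setoid (Fin k)) : crossKernel x σ o = 0 := by
  unfold crossKernel
  have h1 : ∀ i j : Fin r, (if i ≠ j ∧ o = x i ∧ σ = x j then (1 : ℝ) else 0) = 0 := by
    intro i j
    rw [if_neg]
    rintro ⟨-, h, -⟩
    exact hO.ne_cell o ho i h
  rw [if_neg (fun h => hO.ne_bot o ho h.2), if_neg (fun h => hO.ne_top o ho h.2),
    Finset.sum_eq_zero (fun i _ => Finset.sum_eq_zero (fun j _ => h1 i j))]
  norm_num

/-- A strict comparison between admissible cells starts at `⊥` or ends at `⊤` (the middle cells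
form an antichain). -/
theorem IsAdmissibleCell.lt_cases (hx : IsCrossingFamily x) (hbot : ∀ i, x i ≠ ⊥)
    (htop : ∀ i, x i ≠ ⊤) (hne : (⊥ : Setoid (Fin k)) ≠ ⊤) (hO : IsNeutral x O)
    {a b : Setoid (Fin k)} (ha : IsAdmissibleCell x O a) (hb : IsAdmissibleCell x O b) (h : a < b) :
    (a = ⊥ ∧ ((∃ i, b = x i) ∨ b ∈ O)) ∨ (a = ⊥ ∧ b = ⊤) ∨ (((∃ i, a = x i) ∨ a ∈ O) ∧ b = ⊤) := by
  rcases ha with rfl | rfl | ⟨i, rfl⟩ | ha <;> rcases hb with rfl | rfl | ⟨j, rfl⟩ | hb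
  · exact absurd h (lt_irrefl _)
  · exact Or.inr (Or.inl ⟨rfl, rfl⟩)
  · exact Or.inl ⟨rfl, Or.inl ⟨j, rfl⟩⟩
  · exact Or.inl ⟨rfl, Or.inr hb⟩
  · exact absurd (top_le_iff.1 h.le) hne
  · exact absurd h (lt_irrefl _)
  · exact absurd (top_le_iff.1 h.le) (htop j)
  · exact absurd (top_le_iff.1 h.le) (hO.ne_top b hb)
  · exact absurd (le_bot_iff.1 h.le) (hbot i)
  · exact Or.inr (Or.inr ⟨Or.inl ⟨i, rfl⟩, rfl⟩)
  · exact absurd ((hx.le_iff hbot).1 h.le) (fun hij => h.ne (by rw [hij]))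
  · exact absurd h.le (hO.not_cell_le b hb i)
  · exact absurd (le_bot_iff.1 h.le) (hO.ne_bot a ha)
  · exact Or.inr (Or.inr ⟨Or.inr ha, rfl⟩)
  · exact absurd h.le (hO.not_le_cell a ha j)
  · exact absurd (hO.antichain a ha b hb h.le) h.ne

/-- The family kernel at two middle cells lies in `[-1, 0]`. -/
theorem crossKernel_middle_bounds (hx : IsCrossingFamily x) (hbot : ∀ i, x i ≠ ⊥)
    (htop : ∀ i, x i ≠ ⊤) (hO : IsNeutral x O) {m m' : Setoid (Fin k)}
    (hm : (∃ i, m = x i) ∨ m ∈ O) (hm' : (∃ i, m' = x i) ∨ m' ∈ O) :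
    -1 ≤ crossKernel x m m' ∧ crossKernel x m m' ≤ 0 := by
  rcases hm with ⟨i, rfl⟩ | hm
  · rcases hm' with ⟨j, rfl⟩ | hm'
    · rw [crossKernel_cell_cell hx.injective hbot htop]
      split_ifs <;> norm_num
    · rw [crossKernel_neutral_right hO hm']
      norm_num
  · rw [crossKernel_neutral_left hO hm]
    norm_num

/-- The family kernel at `(⊤, m)`, `(m, ⊤)`, `(⊥, m)`, `(m, ⊥)` vanishes for a middle cell `m`. -/
theorem crossKernel_middle_extreme (hbot : ∀ i, x i ≠ ⊥) (htop : ∀ i, x i ≠ ⊤)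
    (hne : (⊥ : Setoid (Fin k)) ≠ ⊤) (hO : IsNeutral x O) {m : Setoid (Fin k)}
    (hm : (∃ i, m = x i) ∨ m ∈ O) :
    crossKernel x ⊤ m = 0 ∧ crossKernel x m ⊤ = 0 ∧ crossKernel x ⊥ m = 0 ∧
      crossKernel x m ⊥ = 0 := by
  rcases hm with ⟨i, rfl⟩ | hm
  · exact ⟨crossKernel_top_cell hbot htop i, crossKernel_cell_top hbot htop i,
      crossKernel_bot_cell hbot htop hne i,
      crossKernel_cell_bot hbot htop i⟩
  · exact ⟨crossKernel_neutral_right hO hm _, crossKernel_neutral_left hO hm _,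
      crossKernel_neutral_right hO hm _, crossKernel_neutral_left hO hm _⟩

/-- **The family kernel is SMC on the admissible cells**: nonpositive second differences on all
comparable pairs of `{⊥, ⊤} ∪ range x ∪ O`. -/
theorem crossKernel_second_difference_of_isAdmissibleCell (hx : IsCrossingFamily x)
    (hbot : ∀ i, x i ≠ ⊥) (htop : ∀ i, x i ≠ ⊤) (hne : (⊥ : Setoid (Fin k)) ≠ ⊤)
    (hO : IsNeutral x O) {a b a' b' : Setoid (Fin k)} (ha : IsAdmissibleCell x O a)
    (hb : IsAdmissibleCell x O b) (ha' : IsAdmissibleCell x O a') (hb' : IsAdmissibleCell x O b')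
    (hab : a ≤ b) (hab' : a' ≤ b') :
    crossKernel x b b' - crossKernel x b a' - crossKernel x a b' + crossKernel x a a' ≤ 0 := by
  rcases eq_or_lt_of_le hab with rfl | hab
  · linarith
  rcases eq_or_lt_of_le hab' with rfl | hab'
  · linarith
  have hTB := crossKernel_top_bot (x := x) hbot hne
  have hBT := crossKernel_bot_top (x := x) hbot hne
  have hTT := crossKernel_self hx.injective hne (⊤ : Setoid (Fin k))
  have hBB := crossKernel_self hx.injective hne (⊥ : Setoid (Fin k))
  rcases IsAdmissibleCell.lt_cases hx hbot htop hne hO ha hb hab with ⟨rfl, hm⟩ | ⟨rfl, rfl⟩ |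
      ⟨hm, rfl⟩ <;>
    rcases IsAdmissibleCell.lt_cases hx hbot htop hne hO ha' hb' hab' with ⟨rfl, hm'⟩ |
      ⟨rfl, rfl⟩ | ⟨hm', rfl⟩
  · obtain ⟨e1, e2, e3, e4⟩ := crossKernel_middle_extreme hbot htop hne hO hm
    obtain ⟨f1, f2, f3, f4⟩ := crossKernel_middle_extreme hbot htop hne hO hm'
    have := crossKernel_middle_bounds hx hbot htop hO hm hm'
    linarith [this.1, this.2]
  · obtain ⟨e1, e2, e3, e4⟩ := crossKernel_middle_extreme hbot htop hne hO hm
    linarith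
  · obtain ⟨e1, e2, e3, e4⟩ := crossKernel_middle_extreme hbot htop hne hO hm
    obtain ⟨f1, f2, f3, f4⟩ := crossKernel_middle_extreme hbot htop hne hO hm'
    have := crossKernel_middle_bounds hx hbot htop hO hm hm'
    linarith [this.1, this.2]
  · obtain ⟨f1, f2, f3, f4⟩ := crossKernel_middle_extreme hbot htop hne hO hm'
    linarith
  · linarith
  · obtain ⟨f1, f2, f3, f4⟩ := crossKernel_middle_extreme hbot htop hne hO hm'
    linarith
  · obtain ⟨e1, e2, e3, e4⟩ := crossKernel_middle_extreme hbot htop hne hO hm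
    obtain ⟨f1, f2, f3, f4⟩ := crossKernel_middle_extreme hbot htop hne hO hm'
    have := crossKernel_middle_bounds hx hbot htop hO hm hm'
    linarith [this.1, this.2]
  · obtain ⟨e1, e2, e3, e4⟩ := crossKernel_middle_extreme hbot htop hne hO hm
    linarith
  · obtain ⟨e1, e2, e3, e4⟩ := crossKernel_middle_extreme hbot htop hne hO hm
    obtain ⟨f1, f2, f3, f4⟩ := crossKernel_middle_extreme hbot htop hne hO hm'
    have := crossKernel_middle_bounds hx hbot htop hO hm hm'
    linarith [this.1, this.2]

/-- **Lemma B for maps whose image minus `{⊥, ⊤}` is an antichain** (any crossing family with proper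
cells, any neutral set, any `d`). -/
theorem LemmaBFamily_of_antichain_image (hx : IsCrossingFamily x) (hbot : ∀ i, x i ≠ ⊥)
    (htop : ∀ i, x i ≠ ⊤) (hne : (⊥ : Setoid (Fin k)) ≠ ⊤) {O : Set (Setoid (Fin k))}
    (hO : IsNeutral x O) {S : Type} [Fintype S] [DecidableEq S]
    (c : Config S → Setoid (Fin k)) (hc : Monotone c) (hM : ∀ σ, IsAdmissibleCell x O (c σ)) :
    crossCount x c ≤ topBotCount c := by
  let c' : Config S → {s : Setoid (Fin k) // IsAdmissibleCell x O s} := fun σ => ⟨c σ, hM σ⟩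
  have hc' : Monotone c' := fun σ τ h => Subtype.mk_le_mk.2 (hc h)
  have h := sum_kernel_compl_nonneg hc' (fun a b => crossKernel x a.1 b.1)
    (fun a => le_of_eq (crossKernel_self hx.injective hne a.1).symm)
    (fun a b a' b' hab hab' => crossKernel_second_difference_of_isAdmissibleCell hx hbot htop hne hO
      a.2 b.2 a'.2 b'.2 hab hab')
  change 0 ≤ ∑ σ : Config S, crossKernel x (c σ) (c σᶜ) at h
  rw [sum_crossKernel_compl hx.injective] at h
  have h' : (crossCount x c : ℝ) ≤ topBotCount c := by linarith
  exact_mod_cast h'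

end Antichain

/-! ### `k = 4`: the four 3|1 cells are neutral; Lemma B without the rank-1 cells -/

/-- The four 3|1 partitions of four indices: `abc|d`, `abd|c`, `acd|b`, `bcd|a`. -/
def three1 : Fin 4 → Setoid (Fin 4) :=
  ![Setoid.ker ![0, 0, 0, 1], Setoid.ker ![0, 0, 1, 0], Setoid.ker ![0, 1, 0, 0],
    Setoid.ker ![0, 1, 1, 1]]

/-- Membership in `three1 k`, read off the labels. -/
theorem three1_rel (k : Fin 4) (a b : Fin 4) :
    three1 k a b ↔ (![![0, 0, 0, 1], ![0, 0, 1, 0], ![0, 1, 0, 0], ![0, 1, 1, 1]] k : Fin 4 → ℕ) a =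
      ![![0, 0, 0, 1], ![0, 0, 1, 0], ![0, 1, 0, 0], ![0, 1, 1, 1]] k b := by
  fin_cases k <;> rfl

/-- Refinement between kernels of labelings, as a decidable statement on the labels. -/
theorem Setoid.ker_le_ker_iff {α β γ : Type*} {f : α → β} {g : α → γ} :
    Setoid.ker f ≤ Setoid.ker g ↔ ∀ a b, f a = f b → g a = g b := by
  rw [Setoid.le_def]
  constructor
  · intro h a b hab
    exact Setoid.ker_def.1 (h (Setoid.ker_def.2 hab))
  · intro h a b hab
    exact Setoid.ker_def.2 (h a b (Setoid.ker_def.1 hab))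

/-- `¬ ker f ≤ ker g` from the decidable statement on the labels. -/
theorem Setoid.ker_not_le_ker {α β γ : Type*} {f : α → β} {g : α → γ}
    (h : ¬ ∀ a b, f a = f b → g a = g b) : ¬ Setoid.ker f ≤ Setoid.ker g :=
  fun hle => h (Setoid.ker_le_ker_iff.1 hle)

/-- The 3|1 cells are not the discrete partition. -/
theorem three1_ne_bot (k : Fin 4) : three1 k ≠ ⊥ := by
  intro h
  have h1 : three1 k 0 1 ∨ three1 k 0 2 ∨ three1 k 1 2 := by
    simp only [three1_rel]
    fin_cases k <;> simp
  rw [h] at h1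
  rcases h1 with h1 | h1 | h1 <;> exact absurd (show (_ : Fin 4) = _ from h1) (by decide)

/-- The 3|1 cells are not the one-block partition. -/
theorem three1_ne_top (k : Fin 4) : three1 k ≠ ⊤ := by
  intro h
  have h1 : ¬ (three1 k 0 3 ∧ three1 k 1 3 ∧ three1 k 2 3 ∧ three1 k 0 1) := by
    simp only [three1_rel]
    fin_cases k <;> simp
  rw [h] at h1
  exact h1 ⟨trivial, trivial, trivial, trivial⟩

/-- A 3|1 cell is not below a crossing cell. -/
theorem not_three1_le_cross4 (k : Fin 4) (i : Fin 3) : ¬ three1 k ≤ cross4 i := by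
  fin_cases k <;> fin_cases i <;> exact Setoid.ker_not_le_ker (by decide)

/-- A crossing cell is not below a 3|1 cell. -/
theorem not_cross4_le_three1 (k : Fin 4) (i : Fin 3) : ¬ cross4 i ≤ three1 k := by
  fin_cases k <;> fin_cases i <;> exact Setoid.ker_not_le_ker (by decide)

/-- A 3|1 cell is never a crossing cell. -/
theorem three1_ne_cross4 (k : Fin 4) (i : Fin 3) : three1 k ≠ cross4 i :=
  fun h => not_three1_le_cross4 k i (h ▸ le_rfl)

/-- Two 3|1 cells are comparable only when equal. -/
theorem three1_le_three1_iff {k l : Fin 4} : three1 k ≤ three1 l ↔ k = l := by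
  constructor
  · intro h
    by_contra hkl
    revert h
    fin_cases k <;> fin_cases l <;> (try exact absurd rfl hkl) <;>
      exact Setoid.ker_not_le_ker (by decide)
  · rintro rfl
    exact le_rfl

/-- The 3|1 cells form a neutral set for the crossing family of four indices. -/
theorem three1_isNeutral : IsNeutral cross4 (Set.range three1) where
  ne_bot := by rintro _ ⟨k, rfl⟩; exact three1_ne_bot k
  ne_top := by rintro _ ⟨k, rfl⟩; exact three1_ne_top k
  ne_cell := by rintro _ ⟨k, rfl⟩ i; exact three1_ne_cross4 k i
  not_le_cell := by rintro _ ⟨k, rfl⟩ i; exact not_three1_le_cross4 k i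
  not_cell_le := by rintro _ ⟨k, rfl⟩ i; exact not_cross4_le_three1 k i
  antichain := by
    rintro _ ⟨k, rfl⟩ _ ⟨l, rfl⟩ h
    rw [three1_le_three1_iff.1 h]

/-- **Lemma B (k = 4) for maps never taking a rank-1 value, every `d`**: a monotone map into the
partitions of four indices with values in `{⊥, ⊤, ab|cd, ac|bd, ad|bc, abc|d, abd|c, acd|b, bcd|a}`
satisfies Lemma B. The six rank-1 cells `ab|c|d, …` are therefore the whole open problem. -/
theorem LemmaB_of_no_rank1 {S : Type} [Fintype S] [DecidableEq S]
    (c : Config S → Setoid (Fin 4)) (hc : Monotone c)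
    (hM : ∀ σ, c σ = ⊥ ∨ c σ = ⊤ ∨ (∃ i, c σ = cross4 i) ∨ ∃ k, c σ = three1 k) :
    crossCount cross4 c ≤ topBotCount c :=
  LemmaBFamily_of_antichain_image cross4_isCrossingFamily cross4_ne_bot cross4_ne_top
    Setoid.bot_ne_top_fin4 three1_isNeutral c hc (fun σ => by
      rcases hM σ with h | h | h | ⟨k, hk⟩
      · exact Or.inl h
      · exact Or.inr (Or.inl h)
      · exact Or.inr (Or.inr (Or.inl h))
      · exact Or.inr (Or.inr (Or.inr ⟨k, hk.symm⟩)))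

end PercRepro
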